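import Summits.BirchSwinnertonDyer.BirchSwinnertonDyer.Theorems.CongruentShaFreeCutUnrSeriesWeierstrass
import Summits.BirchSwinnertonDyer.BirchSwinnertonDyer.Theorems.CongruentShaFreeCutBDPUpToPowerMapIdentity
import Summits.BirchSwinnertonDyer.Rank1Residual.X11b.Three.UnrSeriesTwist
import Literature.NumberTheory.EllipticCurves.PAdicLFunctionInterpolationProofs
import Mathlib.RingTheory.PowerSeries.WeierstrassPreparation
import Mathlib.RingTheory.RootsOfUnity.AlgebraicallyClosed
import HarnessLib

/-!
# Crux K1 `CumulativeHeegnerInclusionAtThree` (stmt-BirchSwinnertonDyer-24198), line `birth` — STUB A,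
# glue of the route's TWO-LAYER PLAN (b) «LeopoldtReciprocity … (Lettl Thm 1 + LZZ at every finite-order
# character)»: an element of `Λ^ur = R₀⟦T⟧` has FINITELY MANY ZEROS in the open unit disc of `ℂ_p`,
# hence is DETERMINED by its values at the finite-order characters of `Γ`

Width seat bsd-line-chl-k1-p1-w2 (`--supports stmt-BirchSwinnertonDyer-24198`). Step (b) of the line
(`Theses/CumulativeHeegnerLeopoldt.lean` ll. 158–162) reads: «LeopoldtReciprocity: `Col♮(loc_𝔭 κ♮) = ℒ_𝔭 ·
unit` in `Λ^ur ⊗ ℚ` (Lettl Thm 1 + LZZ at every FINITE-ORDER character)», and the frame crux K3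
(`WildSplitFrameAtThree`) notes that the additive local toric integral of Liu–Zhang–Zhang «is printed only
pointwise». Passing from «equal at every finite-order character `χ` of `Γ ≅ ℤ_p`» (i.e. at the points
`T = ζ − 1`, `ζ ∈ μ_{p^∞}`) to «equal in `R₀⟦T⟧`» is an identity principle that the tree did NOT have: the
tree's identity principles (`Literature.….IntSeries.eq_zero_of_infinite_zeros`, Gouvêa Cor. 5.6.3;
`X11b.eq_zero_of_norm_le_of_hasSum_zero_of_tendsto_zero`, isolated zeros) need the zeros to lie in a CLOSED
sub-disc `‖x‖ ≤ ‖ϖ‖ < 1` or to ACCUMULATE at an interior point, while `‖ζ_{p^k} − 1‖ → 1⁻` escapes every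
closed sub-disc; and for merely bounded coefficients (`𝓞_{ℂ_p}⟦T⟧`) the statement is FALSE (a series
`1 + Σ a_k T^{n_k}` with `v(a_k) ↓ 0` has infinitely many zeros tending to the rim). What saves `R₀⟦T⟧` is
that `R₀` is a DISCRETE valuation ring (tree: `X2.HidaLimitAlgebra.isDiscreteValuationRing_unrIntegers`), so
Weierstrass preparation applies (Mathlib `PowerSeries.exists_isWeierstrassFactorization` over the
`(p)`-adically complete `R₀`, tree `…CongruentShaFreeCutUnrSeriesWeierstrass.isAdicComplete_maximalIdeal`):
`L = p^μ · P · U` with `P` a distinguished POLYNOMIAL and `U` a unit, and a unit of `R₀⟦T⟧` has no zero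
in the open disc.

## What is proved (THEOREMS ONLY; every prime `p`)

* §1 values of polynomials and units: `hasValueAt_coe_polynomial` (`P(x)` is the finite sum),
  `value_ne_zero_of_isUnit` (a unit of `R₀⟦T⟧` does not vanish at any `‖x‖ < 1`); differences are the
  tree's `…CongruentShaFreeCutBDPUpToPowerMapIdentity.hasValueAt_sub` (imported, not restated).
* §2 **`finite_zeros`**: for `L ≠ 0` in `R₀⟦T⟧` the set `{x ∈ ℂ_p : ‖x‖ < 1 ∧ L(x) = 0}` is finite (it lies
  in the root set of the Weierstrass polynomial of `L / p^{μ(L)}`); **`eq_zero_of_infinite_zeros`**;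
  **`eq_of_infinite_hasValueAt_eq`** (two elements of `R₀⟦T⟧` with a common value at infinitely many points
  of the open disc are equal).
* §3 the finite-order characters: `norm_lt_one_of_one_add_pow_eq_one` (`‖ζ − 1‖ < 1` for `ζ ∈ μ_{p^∞}`,
  tree lemma), `infinite_torsionPoints` (the set `{ζ − 1 : ζ ∈ μ_{p^∞}(ℂ_p)}` is infinite — `ℂ_p` is
  algebraically closed of characteristic `0`, Mathlib `HasEnoughRootsOfUnity`), and the consumer shape
  **`eq_of_hasValueAt_eq_torsionPoints`**: two elements of `R₀⟦T⟧` taking a common value at `ζ − 1` for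
  every `p`-power root of unity `ζ` are EQUAL — «equality at every finite-order character of `Γ` ⟹
  equality in `Λ^ur`», the glue step (b) and K3 invoke on LZZ's pointwise formula.

HONEST FRAMING: pure `p`-adic algebra on the receptacle; nothing about elliptic curves, no reciprocity
law, no `L`-function is constructed or compared here; closes nothing by itself. No definition, no named
fact, no `sorry`. BSD is not proved by any of this.

References: [Washington1997] §7.1 Thm. 7.3 (Weierstrass preparation) and Cor. 7.4 (finitely many
zeros); [Cassels1986] Ch. 6 §5; route-BirchSwinnertonDyer-CumulativeHeegnerLeopoldt TWO-LAYER PLAN (b),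
crux #4 (why it might fail: «printed only pointwise»).
-/

set_option autoImplicit false
-- `…BirchSwinnertonDyer.BirchSwinnertonDyer.Theorems…` is the problem's mandated namespace (D-0017).
set_option linter.dupNamespace false

noncomputable section

open scoped Classical

open PowerSeries Literature.NumberTheory.EllipticCurves
  Summit.BirchSwinnertonDyer.Rank1Residual.X11b.Halves
  Summit.BirchSwinnertonDyer.Rank1Residual.X2.HidaLimitAlgebra
  Summit.BirchSwinnertonDyer.BirchSwinnertonDyer.Theorems.CongruentShaFreeCutUnrSeriesWeierstrass

open Summit.BirchSwinnertonDyer.BirchSwinnertonDyer.Theorems.CongruentShaFreeCutBDPUpToPowerMapIdentity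
  (hasValueAt_sub)

namespace Summit.BirchSwinnertonDyer.BirchSwinnertonDyer.Theorems.CumulativeHeegnerInclusionAtThreeUnrSeriesZeros

variable {p : ℕ} [hp : Fact p.Prime]

/-! ### §1 Values of polynomials, of differences, and of units of `R₀⟦T⟧` -/

/-- **A polynomial `P ∈ R₀[T]`, seen in `R₀⟦T⟧`, has value `P(x)` at every `x ∈ ℂ_p`** (the `HasSum`
defining `UnrSeries.HasValueAt` is a finite sum). [folklore] -/
theorem hasValueAt_coe_polynomial (P : Polynomial (unrIntegers p)) (x : ℂ_[p]) :
    UnrSeries.HasValueAt (P : UnrSeries p) x ((P.map (unrIntegers p).subtype).eval x) := by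
  unfold UnrSeries.HasValueAt
  rw [Polynomial.eval_map, Polynomial.eval₂_eq_sum_range]
  refine (hasSum_sum_of_ne_finset_zero (s := Finset.range (P.natDegree + 1)) ?_).congr_fun ?_
  · intro k hk
    rw [Finset.mem_range, not_lt] at hk
    rw [Polynomial.coeff_eq_zero_of_natDegree_lt (by omega), map_zero, zero_mul]
  · intro k
    rw [Polynomial.coeff_coe]
    rfl

/-- **A unit of `R₀⟦T⟧` has no zero in the open unit disc**: if `U` is a unit and `U(x) = u` with
`‖x‖ < 1`, then `u ≠ 0` (`U · U⁻¹ = 1` is evaluated by the product rule). [cite: Washington1997, §7.1] -/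
theorem value_ne_zero_of_isUnit {U : UnrSeries p} (hU : IsUnit U) {x u : ℂ_[p]} (hx : ‖x‖ < 1)
    (hu : U.HasValueAt x u) : u ≠ 0 := by
  obtain ⟨V, hV⟩ := hU.exists_right_inv
  obtain ⟨w, hw⟩ := exists_hasValueAt V hx
  have h1 : UnrSeries.HasValueAt (U * V) x (u * w) := hasValueAt_mul hx hu hw
  rw [hV] at h1
  have h2 : u * w = 1 := h1.unique (hasValueAt_one x)
  intro h0
  rw [h0, zero_mul] at h2
  exact zero_ne_one h2

/-! ### §2 Finitely many zeros in the open disc; the identity principle on `R₀⟦T⟧` -/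

/-- **A non-zero element of `Λ^ur = R₀⟦T⟧` has finitely many zeros in the open unit disc of `ℂ_p`**
(Washington Cor. 7.4 for `R₀`): write `L = p^μ · L₀` with `L₀ ≢ 0 (mod p)` (`p`-content, tree), and
`L₀ = P · U` (Weierstrass preparation over the complete DVR `R₀`, Mathlib) with `P` a distinguished
polynomial and `U` a unit; then `L(x) = p^μ · P(x) · U(x)` with `p^μ ≠ 0`, `U(x) ≠ 0`, so every zero of `L`
with `‖x‖ < 1` is a root of the (monic, non-zero) polynomial `P`. [cite: Washington1997, §7.1 Thm. 7.3] -/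
theorem finite_zeros {L : UnrSeries p} (hL : L ≠ 0) :
    {x : ℂ_[p] | ‖x‖ < 1 ∧ L.HasValueAt x 0}.Finite := by
  haveI := isDiscreteValuationRing_unrIntegers (p := p)
  haveI : IsAdicComplete (IsLocalRing.maximalIdeal (unrIntegers p)) (unrIntegers p) :=
    isAdicComplete_maximalIdeal
  obtain ⟨μ, L₀, hLμ, hL₀⟩ := UnrSeries.exists_eq_C_pow_mul_map_residue_ne_zero hL
  obtain ⟨P, U, H⟩ := L₀.exists_isWeierstrassFactorization hL₀
  -- the candidate finite set: the roots of `P` in `ℂ_p`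
  set Pc : Polynomial ℂ_[p] := P.map (unrIntegers p).subtype with hPc
  have hPc0 : Pc ≠ 0 := Polynomial.map_monic_ne_zero H.isDistinguishedAt.monic
  refine (Pc.roots.toFinset.finite_toSet).subset ?_
  rintro x ⟨hx, hx0⟩
  -- evaluate `L = C (p^μ) * (P * U)` at `x`
  obtain ⟨u, hu⟩ := exists_hasValueAt U hx
  have hPU : UnrSeries.HasValueAt ((P : UnrSeries p) * U) x (Pc.eval x * u) :=
    hasValueAt_mul hx (hasValueAt_coe_polynomial P x) hu
  have hLval : UnrSeries.HasValueAt L x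
      (((((p : ℕ) : unrIntegers p) ^ μ : unrIntegers p) : ℂ_[p]) * (Pc.eval x * u)) := by
    rw [hLμ, H.eq_mul]
    exact hasValueAt_C_mul _ hPU
  have hzero : ((((p : ℕ) : unrIntegers p) ^ μ : unrIntegers p) : ℂ_[p]) * (Pc.eval x * u) = 0 :=
    hLval.unique hx0
  -- `p^μ ≠ 0` and `U(x) ≠ 0`, so `P(x) = 0`
  have hpμ : ((((p : ℕ) : unrIntegers p) ^ μ : unrIntegers p) : ℂ_[p]) ≠ 0 := by
    rw [SubmonoidClass.coe_pow]
    exact pow_ne_zero _ (by exact_mod_cast hp.out.ne_zero)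
  have hune : u ≠ 0 := value_ne_zero_of_isUnit H.isUnit hx hu
  have hPx : Pc.eval x = 0 := by
    rcases mul_eq_zero.mp hzero with h | h
    · exact absurd h hpμ
    · rcases mul_eq_zero.mp h with h' | h'
      · exact h'
      · exact absurd h' hune
  simp only [Finset.mem_coe, Multiset.mem_toFinset]
  exact (Polynomial.mem_roots hPc0).mpr hPx

/-- **Identity principle on `R₀⟦T⟧`**: an element vanishing at infinitely many points of the open unit
disc is `0`. [cite: Washington1997, §7.1 Thm. 7.3] -/
theorem eq_zero_of_infinite_zeros {L : UnrSeries p} {S : Set ℂ_[p]} (hS : S.Infinite)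
    (h : ∀ x ∈ S, ‖x‖ < 1 ∧ L.HasValueAt x 0) : L = 0 := by
  by_contra hL
  exact (hS.mono fun x hx ↦ h x hx) (finite_zeros hL)

/-- **Two elements of `R₀⟦T⟧` with a common value at infinitely many points of the open unit disc are
equal.** [cite: Washington1997, §7.1 Thm. 7.3] -/
theorem eq_of_infinite_hasValueAt_eq {L L' : UnrSeries p} {S : Set ℂ_[p]} (hS : S.Infinite)
    (h : ∀ x ∈ S, ‖x‖ < 1 ∧ ∃ v : ℂ_[p], L.HasValueAt x v ∧ L'.HasValueAt x v) : L = L' := by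
  have h0 : L - L' = 0 := by
    refine eq_zero_of_infinite_zeros hS fun x hx ↦ ?_
    obtain ⟨hx1, v, hv, hv'⟩ := h x hx
    have := hasValueAt_sub hv hv'
    rw [sub_self] at this
    exact ⟨hx1, this⟩
  exact sub_eq_zero.mp h0

/-! ### §3 The finite-order characters of `Γ`: the points `ζ − 1`, `ζ ∈ μ_{p^∞}(ℂ_p)` -/

/-- `‖ζ − 1‖ < 1` for a `p`-power root of unity `ζ ∈ ℂ_p` (the finite-order characters of `Γ ≅ ℤ_p` sit in
the open disc around the trivial character); the tree's
`Literature.….norm_sub_one_lt_one_of_pow_prime_pow_eq_one`, restated for the variable `x = ζ − 1`.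
[folklore] -/
theorem norm_lt_one_of_one_add_pow_eq_one {x : ℂ_[p]} {k : ℕ} (h : (1 + x) ^ p ^ k = 1) : ‖x‖ < 1 := by
  have := norm_sub_one_lt_one_of_pow_prime_pow_eq_one h
  rwa [add_sub_cancel_left] at this

/-- **There are infinitely many `p`-power roots of unity in `ℂ_p`** (algebraically closed of
characteristic `0`: a PRIMITIVE `p^k`-th root of unity exists for every `k`, Mathlib
`HasEnoughRootsOfUnity`, and primitive roots of distinct orders are distinct), stated for the points
`x = ζ − 1`: the set `{x : (1 + x)^{p^k} = 1 for some k}` is infinite. [folklore] -/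
theorem infinite_torsionPoints : {x : ℂ_[p] | ∃ k : ℕ, (1 + x) ^ p ^ k = 1}.Infinite := by
  -- `k ↦ ζ_k − 1`, `ζ_k` a primitive `p^k`-th root of unity, is injective into the set
  have hprim : ∀ k : ℕ, ∃ ζ : ℂ_[p], IsPrimitiveRoot ζ (p ^ k) := fun k ↦ by
    haveI : NeZero ((p : ℕ) : ℂ_[p]) := ⟨by exact_mod_cast hp.out.ne_zero⟩
    exact HasEnoughRootsOfUnity.exists_primitiveRoot ℂ_[p] (p ^ k)
  choose ζ hζ using hprim
  have hinj : Function.Injective fun k : ℕ ↦ ζ k - 1 := by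
    intro k l hkl
    have hzl : ζ k = ζ l := sub_left_injective hkl
    have h1 : p ^ k = p ^ l := (hζ k).unique (hzl ▸ hζ l)
    exact Nat.pow_right_injective hp.out.two_le h1
  refine Set.infinite_of_injective_forall_mem hinj fun k ↦ ?_
  exact ⟨k, by rw [add_sub_cancel, (hζ k).pow_eq_one]⟩

/-- **«Equality at every finite-order character of `Γ` ⟹ equality in `Λ^ur`.»** If two elements `L, L'`
of `R₀⟦T⟧` take a COMMON value at `T = ζ − 1` for every `p`-power root of unity `ζ ∈ ℂ_p` (i.e. at every
finite-order character `γ ↦ ζ` of `Γ`, `1 + T ↔ γ`), then `L = L'`. This is the glue the line's step (b)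
(«LZZ at every finite-order character») and the frame crux K3 («printed only pointwise») invoke; it holds
because `R₀` is a DISCRETE valuation ring (it fails over `𝓞_{ℂ_p}`). [cite: Washington1997, §7.1 Thm. 7.3] -/
theorem eq_of_hasValueAt_eq_torsionPoints {L L' : UnrSeries p}
    (h : ∀ (x : ℂ_[p]) (k : ℕ), (1 + x) ^ p ^ k = 1 →
      ∃ v : ℂ_[p], L.HasValueAt x v ∧ L'.HasValueAt x v) : L = L' :=
  eq_of_infinite_hasValueAt_eq infinite_torsionPoints fun x ⟨k, hk⟩ ↦
    ⟨norm_lt_one_of_one_add_pow_eq_one hk, h x k hk⟩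

/-- The same with the hypothesis only at the NON-TRIVIAL finite-order characters of sufficiently large
order — any infinite family suffices: if `L`, `L'` share a value at `ζ − 1` for every primitive `p^k`-th
root of unity `ζ` with `k ≥ k₀`, then `L = L'`. [cite: Washington1997, §7.1 Thm. 7.3] -/
theorem eq_of_hasValueAt_eq_primitiveRoots {L L' : UnrSeries p} (k₀ : ℕ)
    (h : ∀ (ζ : ℂ_[p]) (k : ℕ), k₀ ≤ k → IsPrimitiveRoot ζ (p ^ k) →
      ∃ v : ℂ_[p], L.HasValueAt (ζ - 1) v ∧ L'.HasValueAt (ζ - 1) v) : L = L' := by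
  have hprim : ∀ k : ℕ, ∃ ζ : ℂ_[p], IsPrimitiveRoot ζ (p ^ (k₀ + k)) := fun k ↦ by
    haveI : NeZero ((p : ℕ) : ℂ_[p]) := ⟨by exact_mod_cast hp.out.ne_zero⟩
    exact HasEnoughRootsOfUnity.exists_primitiveRoot ℂ_[p] (p ^ (k₀ + k))
  choose ζ hζ using hprim
  have hinj : Function.Injective fun k : ℕ ↦ ζ k - 1 := by
    intro k l hkl
    have hzl : ζ k = ζ l := sub_left_injective hkl
    have h1 : p ^ (k₀ + k) = p ^ (k₀ + l) := (hζ k).unique (hzl ▸ hζ l)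
    have := Nat.pow_right_injective hp.out.two_le h1
    omega
  refine eq_of_infinite_hasValueAt_eq (Set.infinite_range_of_injective hinj) ?_
  rintro x ⟨k, rfl⟩
  refine ⟨?_, h (ζ k) (k₀ + k) (by omega) (hζ k)⟩
  have h1 : (1 + (ζ k - 1)) ^ p ^ (k₀ + k) = 1 := by rw [add_sub_cancel, (hζ k).pow_eq_one]
  exact norm_lt_one_of_one_add_pow_eq_one h1

end Summit.BirchSwinnertonDyer.BirchSwinnertonDyer.Theorems.CumulativeHeegnerInclusionAtThreeUnrSeriesZeros

end
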